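import Mathlib
import Literature.MathematicalPhysics.QuantumFieldTheory.Balaban1983to89.B10Eq27AxialLog
import Literature.MathematicalPhysics.QuantumFieldTheory.Balaban1983to89.B10Eq32SuN
import Literature.MathematicalPhysics.QuantumFieldTheory.Balaban1983to89.B7Prop2SpecialUnitary
import Literature.MathematicalPhysics.QuantumFieldTheory.Balaban1983to89.B13Inv214OrbitSUN

/-
Copyright: publication-cell `pub-balaban` (b2b), seat b2b-balaban-b10 gen 27 (v1).  Literature leaf — finite boxes of
`ℤ^d`, the principal-branch logarithm, `SU(N) ⊂ M_N(ℂ)`, one-variable calculus along real rays, and one-line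
applications of the cell's landed theorems only (`…B7Prop1Explicit`, `…B7Prop2Explicit`, `…B7Prop1Local`,
`…B7Prop2SpecialUnitary`, `…B10Eq27AxialLog`, `…B10Eq26SiteGauge`, `…B10Eq29TubeLine`, `…B10Eq31GlobalConj`,
`…B10Eq32SuN`, `…B10Eq61Leaves`, `…B13DerivZeroGauge`, `…B13Inv214Orbit`, `…B13Inv214OrbitSUN`,
`Literature.Analysis.Matrix.DetExp`, imported BY NAME, nothing edited); every theorem is kernel-proved and tagged
[folklore] or [cite: …] (a LOCATED printed shape); the objects are MODEL OBJECTS (functions of finitely many matrix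
variables), never asserted to be Bałaban's; NO new cited facts, NO summit vocabulary.
-/

/-!
# `Balaban1983to89.B10Eq32AxialSuN` — [Balaban1985UV3] pp. 263–264, (26) ⇒ (29) ⇒ (31) ⇒ (32) FOR `G = SU(N)` ON A
# FINITE BOX `Λ ⊂ ℤ^d`, WITH EVERY GAUGE-SIDE BINDER OF THE LINEAGE A THEOREM: the axial generator `iB_φ(c)` of (27)
# is skew-adjoint, small (28) AND TRACELESS on the `SU(N)` slice (so the lineage's binder `hcomm` is discharged), the
# axial gauge is `SU(N)`-valued (so (29) follows from (26) for `SU(N)`-valued transformations), and (31) ⇒ (32) is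
# obtained FROM THE REAL SLICE — (26) on the `SU(N)`-VALUED configurations only (*"(26) holds for all regular gauge
# field configurations"*) makes the derivative at `1` `Ad(SU(N))`-invariant on all complex tangent configurations,
# hence zero on `𝔰𝔩_N = [𝔰𝔲(N), M_N]` (*"𝔤 is semi-simple, the only element invariant is 0"*)

T. Bałaban, *Ultraviolet stability of three-dimensional lattice pure gauge field theories*, Commun. Math. Phys.
**102**, 255–275 (1985) [Balaban1985UV3] (cell paper B10; PDF `paper:balaban1985-cmp102-uv-stability-3d`, journal page
= PDF page + 254); T. Bałaban, *Averaging operations for lattice gauge theories*, Commun. Math. Phys. **98**, 17–51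
(1985) [Balaban1985Averaging] (cell paper B7 = B10's reference [4]; its Lemma 3 p. 31 is the source of the
`G`-dependent radius of the trace-of-logarithm lemma used in §3, typed by b07 as `…B7Prop2SpecialUnitary`).

CITATION HEADER (lean-in-tree rule).  The passages of B10 marked «p002», «p005», «p009», «p010» below were READ AS
IMAGE for this module from the renders `b2b-balaban-ref1/pages/1985-cmp102-uv-stability-3d/1985-cmp102-uv-stability-
3d-pNNN-x2.png`, NNN = 002 (journal p. 256), 005 (p. 259), 009 (p. 263: (26)'s use, the paragraph from *"Now we are
ready"* through (27), (28), (29)), 010 (p. 264: (31), (32) and the two paragraphs around them); the passage marked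
«re-keyed» is copied byte-for-byte from the header of `…B10Eq26SiteGauge` (b10 gen 25, which read it as image).  This
module adds NO cited fact; the manuscript under audit is quoted for the SHAPES of definitions and hypotheses, never
cited for a disputed step.  Siblings imported BY NAME (byte-identical, nothing edited): `…B7Prop1Explicit` (b07:
`Site`, `e`, `hol`, `treeWord`, `plaqWord`, `l1`, `axialFn`, `U1`), `…B7Prop1Local` (b07: `InBox`, `PlaqIn`),
`…B7Prop2Explicit` (b07: `unitaryUnits`, `star_mlog_eq_neg`, `hol_mem_of`), `…B7Prop2SpecialUnitary` (b07:
`specialUnitaryUnits`, `mem_specialUnitaryUnits`, `specialUnitaryUnits_le_unitaryUnits`,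
`ExpMeanLog.trace_mlog_eq_zero`), `…MatrixLog` (`mlog`), `Literature.Analysis.Matrix.DetExp`
(`det_exp_eq_exp_trace`), `…B13Inv214Orbit` (b13: `Ends`, `gaugeAct`, `isUnit_of_mem_unitary`),
`…B13Inv214OrbitSUN` (b13 gen 22: `SiteGaugeInvSU`, `siteGaugeInvSU_of_siteGaugeInv`), `…B13DerivZeroGauge` (b13:
`apply_generator_eq_zero_of_comp_eq`), `…B10Eq29TubeLine` (b10: `cstarAlgebraMatrix`, `TubeCfg`, `expLine`,
`exp_ofReal_smul_mem_unitary`, `logHalfBound_expLine_of_derivZero`), `…B10Eq61PerSite` (b10: `DerivZeroAlongV`),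
`…B10Eq61Leaves` (b10: `expChart`, `differentiableAt_comp_expChart_zero`), `…B10Eq31GlobalConj` (b10: `conjCfg`,
`adCfg`, `gaugeFlow`, `hasDerivAt_gaugeFlow`, `expChart_one_conjCfg`, `star_exp_ofReal_smul`,
`mem_closure_span_range_adCfg`, `commSpan`), `…B10Eq32SuN` (b10 gen 22: `mem_closure_span_suFlow_of_trace_eq_zero`,
`mem_closure_commSpan_of_trace_eq_zero`), `…B10Eq26SiteGauge` (b10 gen 25: `SiteGaugeInv`, `gaugeAct_const`,
`eq29_of_gaugeFix`, `diffAlongV_eq_sub`, `logHalfBound_congr`, `expLine_one_one`, `logHalfBound_sub_of_siteGaugeInv`),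
`…B10Eq27AxialLog` (b10 gen 26: `contour27`, `hol_contour27`, `B27`, `I_smul_B27`, the `_local` bounds
`norm_hol_contour27_sub_one_le_local` / `norm_B27_le_local` / `exp_I_smul_B27_local`, `hol_contour27_mem_unitary`,
`U1_of_unitaryUnits`, `latEnds`, `vals`, `gaugeAct_latEnds_vals`, `unitCfg`, `val_unitCfg`, `vals_unitCfg`,
`unitCfg_mem_unitaryUnits`, `plaq`, `h44_of_plaq_local`, `B27_eq_zero_dim_one`).

WHY THIS MODULE (the open edges it closes, by name).  (a) `…B10Eq26SiteGauge` (gen 25) §7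
`logHalfBound_sub_of_siteGaugeInv` — the lineage's joint theorem «(26) + localization + gauge fixing + holomorphy +
the `LogHalfBound` input ⇒ the `LogHalfBound` for `E X φ − E X 1`» — is stated for a FINITE bond carrier (`[Fintype ι]`)
and carries the gauge-side BINDERS `hgen` (skew-adjoint generator), `hbound` (its size), `hcomm` (generator in the
closure of `[𝔸, 𝔸]`), `hU`, `hfix` (the gauge-fixing datum).  (b) `…B10Eq27AxialLog` (gen 26) typed (27)–(28) and
discharged `hfix`, `hgen`, `hbound` by the AXIAL gauge — but on the INFINITE carrier `ℤ^d` (its HONEST SCOPE (vii): «gen 25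
§7 needs `[Fintype ι]` ⇒ joint theorems not instantiated on `ℤ^d`») and on the `U(𝔸)` slice (its HONEST SCOPE (v):
«tracelessness not typed ⇒ gen 25's `hcomm` not discharged»).  (c) The lineage's typed (31) ⇒ (32)
(`…B13DerivZeroGauge.fderiv_comp_eq_of_invariant`, `…B10Eq32SuN`) needs the invariance of `E X` under GLOBAL
conjugations on an OPEN set of complex configurations (b13 reads p. 264's *"regular gauge field configurations"* as
the analyticity ball), which the lineage so far supplied only from the `U(N)`-form of (26) through the identity
principle of `…B10Eq26TubeIdentity` — a continuation that is FALSE for the `SU(N)`-form (b13 gen 22's toy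
`B13Inv214OrbitSUN.not_siteGaugeInv_toyDet`: `V ↦ det V_b − 1` is invariant under all `SU(N)`-valued transformations
and not under `U(N)`-valued ones).  THIS MODULE: (§1) the finite box carrier `BoxBond lo hi` (bonds of `ℤ^d` with both
endpoints in `Λ = Π[lo, hi]`, a `Fintype`), its endpoint structure `boxEnds` and the extension-by-`1` of box
configurations to `ℤ^d` (`extCfg`; only contours and plaquettes INSIDE `Λ` are ever evaluated on it); (§2) the truncated
axial generator `axialGenBox` (= `iB_φ(c)` of (27) for box bonds `c` within `ℓ¹`-radius `R X` of the base point
`y X ∈ Λ`, else `0`) with `hgen`, `hbound`, `hfix` as THEOREMS (the `_local` forms of gen 26, the gauge transformation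
EXPLICIT: `u = v₀ =` b07's `axialFn`); (§3) on the `SU(N)` slice: `v₀` is `SU(N)`-valued, and `tr B_φ(c) = 0`
(`ExpMeanLog.trace_mlog_eq_zero`: the loop holonomy lies in `SU(N)`), whence `hcomm` via gen 22's
`mem_closure_commSpan_of_trace_eq_zero` — edge (b); (§4) (31) ⇒ (32) FROM THE REAL SLICE for `𝔸 = M_N(ℂ)` and any
finite carrier — edge (c): invariance of `E X` under `V ↦ W V W⋆`, `W ∈ SU(N)`, on the `SU(N)`-VALUED configurations
only, plus differentiability at `1`, give `Ad(W)`-invariance of the derivative at `1` on ALL tangent configurations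
(`fderiv_comp_conjCfg_eq_of_suInvariant`) and then `DerivZeroAlongV` for every traceless-valued generator
(`derivZeroAlongV_of_suInvariant`); (§5) the joint theorems on the box — edge (a) with every gauge-side binder a theorem:
(29) for `SU(N)`-valued gauge fixings (`eq29_axialBox`), the print-faithful `SU(N)` theorem
(`logHalfBound_sub_box_of_siteGaugeInvSU`: (26) in b13's `SU(N)`-form `SiteGaugeInvSU` + localization + (13)-type
plaquette regularity + holomorphy + `LogHalfBound` input ⇒ the `LogHalfBound` for `E X φ − E X 1`), and gen 25 §7
INSTANTIATED (`logHalfBound_sub_box_of_siteGaugeInv`, `U(N)`-form); (§6) non-vacuity on `ℤ¹`.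

WHAT IS PRINTED (verbatim).
* B10 p. 256 («p002»): *"In our case field configurations have values in the compact Lie group G, hence bounds are in
  uniform norms"*.
* B10 p. 259 («p005»): *"The configuration U₁ satisfies the regularity conditions |U₁(∂p) − 1| < 2B₃g₀p(g₀) on Ω₁,
  hence U₁, U′U₁ satisfy the assumptions of Lemma 1 [6] with α₀ = 2L²B₃g₀p(g₀), α₁ = 0"*.
* B10 pp. 262–263 («re-keyed»): *"equalities hold 𝒫′₁(g₀, X, U₁ᵘ) = 𝒫′₁(g₀, X, U₁), (26) for all gauge transformations
  𝓊. The second is a localization property with respect to U₁. The expression 𝒫′₁(g₀, X, U₁) depends on U₁ restricted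
  to the set X̃⁵ (let us recall that X̃⁵ = ∪_{□⊂X} □̃⁵). The third property is the analyticity with respect to U₁."*
* B10 p. 263 («p009»): *"The localization domain X is contained in a cube □ of the size RM₁. We may assume that X̃⁵ ⊂ □
  also, and a center of □ belongs to X. We apply the constructions and results of Sect. F [7]. According to these
  there exists a gauge transformation in a neighbourhood of □₁, where □₁ is a cube of the size 3RM₁ and with the same
  center as □, such that the gauge transformed U₁ is represented as exp i𝓗(B) in the neighbourhood of □₁."*; *"Let y
  denote the center of □. The configuration B restricted to □₁ is defined on □₁^{(1)} = □₁ ∩ T^{(1)} and for a bond c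
  of this set is given by B(c) = (1/i) log V(Γ_{y,c₋} ∪ c ∪ Γ_{c₊,y}). (27) The characteristic functions χ₁ defined
  in (13) give the restrictions |V(∂p′) − 1| < 2L²g₀p(g₀), hence |B(c)| < 4L²|c₋ − y|g₀p(g₀) < 8L²3R₁M₁r(g₀)g₀p(g₀),
  (28)"*; *"By the gauge invariance (26), we have 𝒫′₁(g₀, X, U₁) = 𝒫′₁(g₀, X, exp i𝓗(B)), (29)"*.
* B10 p. 264 («p010»): *"The gauge invariance (26) implies the invariance with respect to the global transformations
  R(U), U ∈ G, hence the equality R(U)((δ/δ𝓗(b))𝒫′₁)(g₀, X, 1) = ((δ/δ𝓗(b))𝒫′₁)(g₀, X, 1). (31) We have to notice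
  only that (26) holds for all regular gauge field configurations, not only for the minimal configurations U₁. The
  derivative in the above formula is an element of the Lie algebra 𝔤, and by the assumption that 𝔤 is semi-simple,
  the only element invariant is 0, and we conclude ((δ/δ𝓗(b))𝒫′₁)(g₀, X, 1) = 0. (32) It is the only place we use
  the semi-simplicity, but the above conclusion is a fundamental point in our method. In the renormalization group
  language it is the statement that there are no relevant variables in the effective action."*

THE MATHEMATICS ([folklore]; four remarks).  (M1) THE BOX.  For `y ∈ Λ` and a bond `c ⊂ Λ` the axial staircase
contours `Γ_{y,c₋}`, `Γ_{y,c₊}` (b07's `treeWord`, coordinates moved monotonically one after the other) stay inside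
the box, and gen 26's `_local` bounds read only the plaquettes INSIDE `Λ` (b07's clamp `B7Prop1Local`); so the
extension of a box configuration by `1` outside `Λ` (`extCfg`) is a bookkeeping device whose junk values are never
read: `B_φ(c)`, its bound (28) from `|φ(∂p) − 1| ≤ α` on the plaquettes `p ⊂ Λ`, and the axial gauge `v₀(x) =
φ(Γ_{y,x})`, `x ∈ Λ`, are functions of `φ` alone, and the site gauge action on box configurations is the `ℤ^d` action
of gen 26 read on box bonds (`gaugeAct_boxEnds`).  (M2) TRACELESSNESS.  For `SU(N)`-valued `φ` the loop holonomy `W =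
φ(Γ_{y,c₋} ∪ c ∪ Γ_{c₊,y})` is a product of elements of `SU(N)`, and for `‖W − 1‖ ≤ 1/3`, `N‖W − 1‖ < π` one has
`tr log W = 0` (b07 `ExpMeanLog.trace_mlog_eq_zero`: `det W = exp tr log W = 1` and `|Im tr log W| < π`); with gen 26's
`‖W − 1‖ ≤ |c₋ − y|₁·α` this holds on every bond with `|c₋ − y|₁·α ≤ 1/4` and `N·|c₋ − y|₁·α < π`.  So `iB_φ(c) =
log W` is skew-Hermitian AND traceless, i.e. `𝔰𝔲(N)`-valued — print's *"𝓗(B) … the Lie algebra 𝔤"* for `G = SU(N)` —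
and lies in `𝔰𝔩_N = [M_N, M_N]` (gen 22's `coe_commSpan_matrix`): the binder `hcomm`.  (M3) (31) ⇒ (32) FROM THE REAL
SLICE.  Let `g(v) = E X(exp-chart of v)` (`v` a complex tangent configuration, `exp-chart(v)_b = exp(v_b)`) be
differentiable at `0` with derivative `ℓ` (ℂ-linear), and let `E X(W V W⋆) = E X(V)` for `W ∈ SU(N)` and all
`SU(N)`-VALUED `V`.  For `w` with every `w_b ∈ 𝔰𝔲(N)` (skew-Hermitian, traceless) and real `t`, `exp(t w_b) ∈ SU(N)`
(`det exp = exp tr`), and `exp-chart(Ad_W(t w)) = W·exp-chart(t w)·W⋆` bondwise, so `g(Ad_W(t w)) = g(t w)` for all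
real `t`; differentiating at `t = 0` (chain rule along the real ray, uniqueness of the derivative) gives `ℓ(Ad_W w) =
ℓ(w)`.  Scalar-valued `w` (`w_b = c_b·1`) are fixed by `Ad_W`.  Every tangent configuration decomposes bondwise as
`w = ½A − (i/2)B + C` with `A`, `B` `𝔰𝔲(N)`-valued and `C` scalar-valued (`A_b = P_b − P_b⋆`, `B_b = i(P_b + P_b⋆)`,
`P_b = w_b − (tr w_b/N)1`), so by ℂ-LINEARITY `ℓ ∘ Ad_W = ℓ` on ALL of `(ι → M_N)` — this is (31) for the derivative as
a linear functional, obtained from invariance on the real slice alone (no open set of complex configurations, no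
identity principle).  Then, along the one-parameter groups `t ↦ Ad_{exp(tS)}`, `S ∈ 𝔰𝔲(N)` (b13's
`apply_generator_eq_zero_of_comp_eq`), `ℓ(ad_S w) = 0` for all `w`; `ℓ` is continuous, so it vanishes on the CLOSED
SPAN of these, which contains every traceless-valued configuration (gen 22: `𝔰𝔩_N = [𝔰𝔲(N), M_N]` bondwise,
`mem_closure_span_suFlow_of_trace_eq_zero` — the printed *"𝔤 is semi-simple, the only element invariant is 0"*);
finally `d/dζ E X(exp(ζ·gen)) |_{ζ=0} = ℓ(gen) = 0` — (32), the binder `h0 : DerivZeroAlongV` of the lineage's engine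
`B10Eq29TubeLine.logHalfBound_expLine_of_derivZero`.  (M4) THE JOIN (§5).  (26) for `SU(N)`-valued site-dependent
transformations at the configurations `φ ∈ sp′ X` + localization to the bonds `dep X` («X̃⁵ ⊂ □», within radius `R X`
of `y X`) + the axial datum (`v₀` `SU(N)`-valued, `φ^{v₀} = exp(iB_φ)` on `dep X`) give (29) `E X φ = E X(exp iB_φ)`
(gen 25's `eq29_of_gaugeFix` with the admissible class "`SU(N)`-valued"); (26) at `u ≡ W` gives the real-slice
invariance of (M3), hence `h0`; the engine turns `h0` + holomorphy on the `a`-tube + the `LogHalfBound` input `(B, r)`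
+ skew-adjointness and size `≤ p + q(1 + d(X))` of the generator into the `LogHalfBound` `(8((p + q)/a)²B, r − 2)` for
the difference along the line, which (29) identifies with `E X φ − E X 1`.

HYPOTHESIS SHAPES (located, never asserted; in print's words).  (h26) `B13Inv214OrbitSUN.SiteGaugeInvSU (boxEnds lo hi)
(E X)` — (26) p. 263 *"for all gauge transformations 𝓊"*, `G = SU(N)`-valued and site-dependent, at all
`SU(N)`-valued configurations of the box (p. 264 *"(26) holds for all regular gauge field configurations, not only
for the minimal configurations U₁"*; see HONEST SCOPE (v)); (hloc, hdep) *"depends on U₁ restricted to the set X̃⁵"*,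
*"X̃⁵ ⊂ □"*, *"y denote the center of □"*: `E X` depends on the bonds `dep X` only, all within `ℓ¹`-radius `R X` of
`y X ∈ Λ`; (hSU) p. 256 *"field configurations have values in the compact Lie group G"*: the configurations of `sp′ X`
are `SU(N)`-valued; (h13) p. 259 *"The configuration U₁ satisfies the regularity conditions |U₁(∂p) − 1| < 2B₃g₀p(g₀)
on Ω₁"* and (13)/(28) *"|V(∂p′) − 1| < 2L²g₀p(g₀)"*: a plaquette regularity `≤ α` of the configurations of `sp′ X` on
the plaquettes inside `Λ`; (hR4, hRπ, hRpq) *"for g₀ sufficiently small the number on the right-hand side above is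
small"*: `R X·α ≤ 1/4`, `N·R X·α < π`, `2R X·α ≤ p + q(1 + d(X))`; (hsp, hE) *"The third property is the analyticity
with respect to U₁"*: `E X` holomorphic on a set containing the `a`-tube; (hEb) the `LogHalfBound` input `(B, r)` on
that set (the lineage's located (25)/(2.14)-type bound, `B13.LogHalfBound`).

HONEST SCOPE / NOT TYPED.  (i) The carrier is a box `Λ = Π[lo, hi] ⊂ ℤ^d` with free boundary (extension by `1`), not
the torus `T_η` and not the `Ω₁`/big-block geometry; *"□₁ … of the size 3RM₁"*, *"X̃⁵ ⊂ □"* are the abstract `dep X`,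
`R X`, `y X` (binders), `M₁`-blocks are not modelled.  (ii) The gauge is the AXIAL gauge of (27) based at `y X` (b07 /
gen 26), NOT print's representative `𝓗(B) = HB + A₁(B)` of Sect. F [7] (Eq. (158); the b11 lineage's
`B11Prop6Scheme`); (29), (31), (32) are typed for the axial representative; the expansion (30) and (33)–(34) in the
coarse variable `B` are not typed here.  (iii) `G = SU(N) ⊂ M_N(ℂ)` with the operator C⋆-norm
(`B10Eq29TubeLine.cstarAlgebraMatrix`); print's `G` is a general compact Lie group, semi-simple at (32); `N ≥ 1` via
`[NeZero N]`, and for `N = 1` (`SU(1) = {1}`) every statement is trivially true; semi-simplicity enters exactly as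
`𝔰𝔩_N = [𝔰𝔲(N), M_N]` (gen 22).  (iv) Smallness radii `R X·α ≤ 1/4` (logarithm series, skewness) and the
`G`-DEPENDENT `N·R X·α < π` (tracelessness of `log` on `SU(N)`; b07's caveat in `…B7Prop2SpecialUnitary`) replace
print's *"for g₀ sufficiently small"*; print's letters for `α` (`2L²g₀p(g₀)`, `2B₃g₀p(g₀)`) are instances, not fixed
here (gen 26 `eq28_print_local` has them); `≤` for print's `<`, `ℓ¹` distance for `|c₋ − y|`.  (v) (h26) quantifies
over ALL `SU(N)`-valued configurations of the box, print's sentence over the *"regular"* ones; the proofs USE (26)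
only at the configurations of `sp′ X` (for (29)) and along the rays `t ↦ exp(t w)`, `w` `𝔰𝔲(N)`-valued, `t` real (for
(31)) — the over-coverage is declared, not hidden.  (vi) (26), localization, `SU(N)`-valuedness, plaquette
regularity, holomorphy and the `LogHalfBound` input are HYPOTHESES on the model family `E` (located shapes of
properties print asserts for `𝒫′₁`), never discharged here; the module proves the IMPLICATION.  (vii) The `U(N)`-form
(`logHalfBound_sub_box_of_siteGaugeInv`, gen 25's `SiteGaugeInv`) is the lineage's model statement instantiated —
`U(N)` is not semi-simple and `SiteGaugeInv` is STRICTLY stronger than `SiteGaugeInvSU` (b13 gen 22 (T1)); it is kept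
as the record that gen 25 §7's binders are now all theorems, the print-faithful statement being the `SU(N)` one.

COLLISION MAP.  Restates nothing of b07 / b13 / b10-g22/25/26: the (26)-hypothesis for `SU(N)` is b13 gen 22's
`SiteGaugeInvSU` BY NAME (no competing predicate), the (27) objects and `_local` bounds are gen 26's BY NAME, the
tracelessness of `log` on `SU(N)` is b07's BY NAME, `𝔰𝔩_N = [𝔰𝔲(N), M_N]` and its closure statements are gen 22's BY
NAME, the one-parameter lemma is b13's BY NAME; b13 gen 22's §5 (continuation of (26)\_{SU} to the sub-tube
`SubTube`, orbit constancy) is a DIFFERENT theorem (complex orbit side) and is not used.  NEW here: the box carrier,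
the truncated axial generator on it with its binders as theorems, tracelessness of (27) on the `SU(N)` slice, the
real-slice route (M3) to (31)–(32), and the joint theorems of §5.
-/

namespace Literature.MathematicalPhysics.QuantumFieldTheory.Balaban1983to89.B10Eq32AxialSuN

open NormedSpace Set Metric Filter
open scoped Topology Matrix.Norms.L2Operator
open B7Prop1Explicit renaming Site → LSite
open B7Prop1Explicit (e hol treeWord plaqWord l1 axialFn U1)
open B7Prop1Local (InBox PlaqIn)
open B7Prop2Explicit (unitaryUnits mem_unitaryUnits star_mlog_eq_neg hol_mem_of)
open B7Prop2SpecialUnitary (specialUnitaryUnits mem_specialUnitaryUnits specialUnitaryUnits_le_unitaryUnits)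
open B13Inv214Orbit (Ends isUnit_of_mem_unitary)
open B13Inv214OrbitSUN (SiteGaugeInvSU siteGaugeInvSU_of_siteGaugeInv)
open B13DerivZeroGauge (apply_generator_eq_zero_of_comp_eq)
open B10Eq29TubeLine (cstarAlgebraMatrix Tube TubeCfg expLine exp_ofReal_smul_mem_unitary
  logHalfBound_expLine_of_derivZero)
open B10Eq61Leaves (expChart differentiableAt_comp_expChart_zero)
open B10Eq61PerSite (DerivZeroAlongV)
open B10Eq31GlobalConj (commSpan conjCfg conjCfg_apply adCfg gaugeFlow hasDerivAt_gaugeFlow expChart_one_conjCfg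
  star_exp_ofReal_smul mem_closure_span_range_adCfg)
open B10Eq26SiteGauge (SiteGaugeInv gaugeAct_const eq29_of_gaugeFix diffAlongV_eq_sub logHalfBound_congr
  expLine_one_one logHalfBound_sub_of_siteGaugeInv)
open B10Eq27AxialLog (contour27 hol_contour27 B27 I_smul_B27 norm_hol_contour27_sub_one_le_local norm_B27_le_local
  exp_I_smul_B27_local hol_contour27_mem_unitary U1_of_unitaryUnits latEnds vals gaugeAct_latEnds_vals unitCfg val_unitCfg
  vals_unitCfg unitCfg_mem_unitaryUnits plaq h44_of_plaq_local B27_eq_zero_dim_one)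
open MatrixLog (mlog)
open _root_.Literature.Analysis.Matrix (det_exp_eq_exp_trace)

/-! ## §1. [folklore] THE FINITE CARRIER: the bonds of a box `Λ = [lo, hi] ⊂ ℤ^d` -/

section carrier

variable {d : ℕ}

/-- The bonds `⟨x, x + e_μ⟩` of `ℤ^d` with BOTH endpoints in the box `[lo, hi]`. [folklore] -/
abbrev BoxBond (lo hi : LSite d) : Type :=
  {b : LSite d × Fin d // InBox lo hi b.1 ∧ InBox lo hi (b.1 + e b.2)}

/-- A box has finitely many bonds. [folklore] -/
instance instFiniteBoxBond (lo hi : LSite d) : Finite (BoxBond lo hi) := by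
  have hsub : {b : LSite d × Fin d | InBox lo hi b.1 ∧ InBox lo hi (b.1 + e b.2)} ⊆
      (Set.Icc lo hi) ×ˢ (Set.univ : Set (Fin d)) := by
    rintro ⟨x, μ⟩ ⟨hx, -⟩
    exact ⟨⟨fun i => (hx i).1, fun i => (hx i).2⟩, Set.mem_univ _⟩
  exact ((Set.finite_Icc lo hi).prod Set.finite_univ).subset hsub |>.to_subtype

/-- … hence a `Fintype` (noncomputably). [folklore] -/
noncomputable instance instFintypeBoxBond (lo hi : LSite d) : Fintype (BoxBond lo hi) := Fintype.ofFinite _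

/-- The endpoint maps `b₋ = x`, `b₊ = x + e_μ` of the box bonds (b13's `Ends`). [folklore] -/
def boxEnds (lo hi : LSite d) : Ends (BoxBond lo hi) (LSite d) where
  src b := b.1.1
  tgt b := b.1.1 + e b.1.2

variable {𝔸 : Type*} [CStarAlgebra 𝔸]

open Classical in
/-- Extension of a configuration on the box bonds to all bonds of `ℤ^d` by `1` (the clamp value; only plaquettes and
contours INSIDE the box are ever evaluated on it). [folklore] -/
noncomputable def extCfg (lo hi : LSite d) (φ : BoxBond lo hi → 𝔸) : LSite d × Fin d → 𝔸 :=
  fun b => if h : InBox lo hi b.1 ∧ InBox lo hi (b.1 + e b.2) then φ ⟨b, h⟩ else 1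

/-- On a box bond the extension is the configuration. [folklore] -/
@[simp] theorem extCfg_coe {lo hi : LSite d} (φ : BoxBond lo hi → 𝔸) (b : BoxBond lo hi) :
    extCfg lo hi φ (b : LSite d × Fin d) = φ b := by
  unfold extCfg
  rw [dif_pos b.2]

/-- Off the box the extension is `1`. [folklore] -/
theorem extCfg_of_not {lo hi : LSite d} (φ : BoxBond lo hi → 𝔸) {b : LSite d × Fin d}
    (h : ¬ (InBox lo hi b.1 ∧ InBox lo hi (b.1 + e b.2))) : extCfg lo hi φ b = 1 := by
  unfold extCfg
  rw [dif_neg h]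

/-- The extension takes values in any submonoid containing the values of `φ`. [folklore] -/
theorem extCfg_mem {lo hi : LSite d} {φ : BoxBond lo hi → 𝔸} {M : Submonoid 𝔸} (hφ : ∀ b, φ b ∈ M)
    (b : LSite d × Fin d) : extCfg lo hi φ b ∈ M := by
  unfold extCfg
  split_ifs with h
  · exact hφ _
  · exact one_mem _

/-- The site gauge action on the box carrier is the site gauge action on `ℤ^d` of the extension, read on box bonds.
[folklore] -/
theorem gaugeAct_boxEnds {lo hi : LSite d} (u : LSite d → 𝔸) (φ : BoxBond lo hi → 𝔸) (b : BoxBond lo hi) :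
    B13Inv214Orbit.gaugeAct (boxEnds lo hi) u φ b =
      B13Inv214Orbit.gaugeAct (latEnds d) u (extCfg lo hi φ) (b : LSite d × Fin d) := by
  simp only [B13Inv214Orbit.gaugeAct, boxEnds, latEnds, extCfg_coe]

end carrier

/-! ## §2. THE AXIAL GENERATOR ON THE BOX and its binders `hgen`, `hbound`, `hfix` (all THEOREMS) -/

section generator

variable {d : ℕ} {𝔸 : Type*} [CStarAlgebra 𝔸]

/-- The truncated axial generator (27) of `B10Eq27AxialLog` on the box carrier: `iB_φ(c)` for box bonds `c` with
`|c₋ − y X|₁ ≤ R X`, else `0`; the holonomies are those of the extension `extCfg φ` (for `y X ∈ Λ` and `c ⊂ Λ` the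
contour `Γ_{y,c₋} ∪ c ∪ Γ_{c₊,y}` is evaluated on the clamped configuration, `B10Eq27AxialLog` §7).
[cite: Balaban1985UV3, (27)–(28) p.263] -/
noncomputable def axialGenBox (lo hi : LSite d) {D : LocDomainSys} (y : D.Dom → LSite d) (R : D.Dom → ℕ) :
    D.Dom → (BoxBond lo hi → 𝔸) → BoxBond lo hi → 𝔸 :=
  fun X φ b => if l1 (b.1.1 - y X) ≤ R X then Complex.I • B27 (unitCfg (extCfg lo hi φ)) (y X) b.1.1 b.1.2 else 0

/-- Within the radius the generator is `iB_φ(c)`. [folklore] -/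
theorem axialGenBox_of_le {lo hi : LSite d} {D : LocDomainSys} (y : D.Dom → LSite d) (R : D.Dom → ℕ) {X : D.Dom}
    (φ : BoxBond lo hi → 𝔸) {b : BoxBond lo hi} (h : l1 (b.1.1 - y X) ≤ R X) :
    axialGenBox lo hi y R X φ b = Complex.I • B27 (unitCfg (extCfg lo hi φ)) (y X) b.1.1 b.1.2 := if_pos h

/-- Outside the radius the generator is `0`. [folklore] -/
theorem axialGenBox_of_not_le {lo hi : LSite d} {D : LocDomainSys} (y : D.Dom → LSite d) (R : D.Dom → ℕ)
    {X : D.Dom} (φ : BoxBond lo hi → 𝔸) {b : BoxBond lo hi} (h : ¬ l1 (b.1.1 - y X) ≤ R X) :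
    axialGenBox lo hi y R X φ b = 0 := if_neg h

variable [Nontrivial 𝔸]

/-- LOCAL skew-adjointness of `iB(c)`: unitary-valued `V`, (13)-type bounds `≤ α` on the plaquettes of a box containing
`y`, `c`, and `|c₋ − y|₁·α ≤ ¼`. (`B10Eq27AxialLog.I_smul_B27_mem_skewAdjoint` with the located hypothesis of its §7.)
[folklore] -/
theorem I_smul_B27_mem_skewAdjoint_local {lo hi : LSite d} (hlohi : ∀ i, lo i ≤ hi i) {V : LSite d → Fin d → 𝔸ˣ}
    (hV : ∀ x κ, V x κ ∈ unitaryUnits 𝔸) {y : LSite d} (hy : InBox lo hi y) {α : ℝ}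
    (h44 : ∀ (x : LSite d) (κ μ : Fin d), κ ≠ μ → PlaqIn lo hi (x, κ, μ) →
      ‖((hol V x (plaqWord κ μ) : 𝔸ˣ) : 𝔸) - 1‖ ≤ α) (hα : 0 ≤ α) {x : LSite d} {μ : Fin d} (hx : InBox lo hi x)
    (hxμ : InBox lo hi (x + e μ)) (hsmall : (l1 (x - y) : ℝ) * α ≤ 1 / 4) :
    Complex.I • B27 V y x μ ∈ skewAdjoint 𝔸 := by
  rw [skewAdjoint.mem_iff, I_smul_B27]
  exact star_mlog_eq_neg (hol_contour27_mem_unitary hV y x μ)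
    ((norm_hol_contour27_sub_one_le_local hlohi V (U1_of_unitaryUnits hV) y h44 hα hy x μ hx hxμ).trans hsmall)

variable {lo hi : LSite d} {D : LocDomainSys} (y : D.Dom → LSite d) (R : D.Dom → ℕ)

/-- **`hgen` on the box**: for unitary-valued `φ` with (13)-type bounds `≤ α` on the plaquettes of `Λ ∋ y X` and
`R X·α ≤ ¼`, the generator is skew-adjoint at every bond. [folklore] -/
theorem axialGenBox_mem_skewAdjoint {X : D.Dom} (hy : InBox lo hi (y X)) {φ : BoxBond lo hi → 𝔸}
    (hφ : ∀ b, φ b ∈ unitary 𝔸) {α : ℝ}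
    (h13 : ∀ (x : LSite d) (κ μ : Fin d), κ ≠ μ → PlaqIn lo hi (x, κ, μ) → ‖plaq (extCfg lo hi φ) x κ μ - 1‖ ≤ α)
    (hα : 0 ≤ α) (hR : (R X : ℝ) * α ≤ 1 / 4) (b : BoxBond lo hi) :
    axialGenBox lo hi y R X φ b ∈ skewAdjoint 𝔸 := by
  have hlohi : ∀ i, lo i ≤ hi i := fun i => (hy i).1.trans (hy i).2
  have hφ' : ∀ b', extCfg lo hi φ b' ∈ unitary 𝔸 := extCfg_mem hφ
  unfold axialGenBox
  split_ifs with h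
  · exact I_smul_B27_mem_skewAdjoint_local hlohi (unitCfg_mem_unitaryUnits hφ') hy (h44_of_plaq_local hφ' h13) hα
      b.2.1 b.2.2 ((mul_le_mul_of_nonneg_right (by exact_mod_cast h) hα).trans hR)
  · exact zero_mem _

/-- **`hbound` on the box**: `‖gen‖ ≤ 2·R X·α` when `R X·α ≤ ½`. [cite: Balaban1985UV3, (28) p.263] -/
theorem norm_axialGenBox_le {X : D.Dom} (hy : InBox lo hi (y X)) {φ : BoxBond lo hi → 𝔸}
    (hφ : ∀ b, φ b ∈ unitary 𝔸) {α : ℝ}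
    (h13 : ∀ (x : LSite d) (κ μ : Fin d), κ ≠ μ → PlaqIn lo hi (x, κ, μ) → ‖plaq (extCfg lo hi φ) x κ μ - 1‖ ≤ α)
    (hα : 0 ≤ α) (hR : (R X : ℝ) * α ≤ 1 / 2) (b : BoxBond lo hi) :
    ‖axialGenBox lo hi y R X φ b‖ ≤ 2 * (R X * α) := by
  have hlohi : ∀ i, lo i ≤ hi i := fun i => (hy i).1.trans (hy i).2
  have hφ' : ∀ b', extCfg lo hi φ b' ∈ unitary 𝔸 := extCfg_mem hφ
  unfold axialGenBox
  split_ifs with h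
  · rw [norm_smul, Complex.norm_I, one_mul]
    have hl : (l1 (b.1.1 - y X) : ℝ) * α ≤ R X * α := mul_le_mul_of_nonneg_right (by exact_mod_cast h) hα
    exact (norm_B27_le_local hlohi _ (U1_of_unitaryUnits (unitCfg_mem_unitaryUnits hφ')) (y X)
      (h44_of_plaq_local hφ' h13) hα hy b.1.1 b.1.2 b.2.1 b.2.2 (hl.trans hR)).trans (by linarith)
  · rw [norm_zero]; exact mul_nonneg zero_le_two (mul_nonneg (Nat.cast_nonneg _) hα)

/-- **`hfix` on the box, with the gauge transformation EXPLICIT**: the axial gauge `u = v₀ = axialFn` of the unit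
configuration of the extension represents `φ` as `exp(gen)` on the box bonds within `ℓ¹`-radius `R X` of `y X`
(`R X·α < 1`). [cite: Balaban1985UV3, p.263 ("fix the gauge … represented as exp i𝓗(B)")] -/
theorem axial_gaugeFix_box {X : D.Dom} (hy : InBox lo hi (y X)) {φ : BoxBond lo hi → 𝔸}
    (hφ : ∀ b, φ b ∈ unitary 𝔸) {α : ℝ}
    (h13 : ∀ (x : LSite d) (κ μ : Fin d), κ ≠ μ → PlaqIn lo hi (x, κ, μ) → ‖plaq (extCfg lo hi φ) x κ μ - 1‖ ≤ α)
    (hα : 0 ≤ α) (hR : (R X : ℝ) * α < 1) (b : BoxBond lo hi) (hb : l1 (b.1.1 - y X) ≤ R X) :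
    B13Inv214Orbit.gaugeAct (boxEnds lo hi)
        (fun x => ((axialFn (unitCfg (extCfg lo hi φ)) (y X) x : 𝔸ˣ) : 𝔸)) φ b =
      exp (axialGenBox lo hi y R X φ b) := by
  have hlohi : ∀ i, lo i ≤ hi i := fun i => (hy i).1.trans (hy i).2
  have hφ' : ∀ b', extCfg lo hi φ b' ∈ unitary 𝔸 := extCfg_mem hφ
  have hV := unitCfg_mem_unitaryUnits hφ'
  have hvals : vals (unitCfg (extCfg lo hi φ)) = extCfg lo hi φ :=
    vals_unitCfg fun b' => isUnit_of_mem_unitary (hφ' b')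
  have hlt : (l1 (b.1.1 - y X) : ℝ) * α < 1 :=
    lt_of_le_of_lt (mul_le_mul_of_nonneg_right (by exact_mod_cast hb) hα) hR
  have h44 := h44_of_plaq_local hφ' h13
  rw [axialGenBox_of_le y R φ hb, gaugeAct_boxEnds]
  set V := unitCfg (extCfg lo hi φ) with hVdef
  rw [← hvals, gaugeAct_latEnds_vals,
    exp_I_smul_B27_local hlohi V (U1_of_unitaryUnits hV) (y X) h44 hα hy b.1.1 b.1.2 b.2.1 b.2.2 hlt, hol_contour27]
  rfl

end generator

/-! ## §3. THE `SU(N)` SLICE: the axial gauge is `SU(N)`-valued and the generator is TRACELESS -/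

section suN

variable (N : ℕ) [NeZero N] {d : ℕ}

attribute [local instance] B10Eq29TubeLine.cstarAlgebraMatrix

omit [NeZero N] in
/-- The axial gauge transformation of an `SU(N)`-valued configuration is `SU(N)`-valued (holonomies of a
subgroup-valued configuration, b07 `hol_mem_of`). [folklore] -/
theorem axialFn_mem_specialUnitaryGroup {lo hi : LSite d} {φ : BoxBond lo hi → Matrix (Fin N) (Fin N) ℂ}
    (hφ : ∀ b, φ b ∈ Matrix.specialUnitaryGroup (Fin N) ℂ) (y x : LSite d) :
    ((axialFn (unitCfg (extCfg lo hi φ)) y x : (Matrix (Fin N) (Fin N) ℂ)ˣ) : Matrix (Fin N) (Fin N) ℂ) ∈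
      Matrix.specialUnitaryGroup (Fin N) ℂ := by
  have hφ' : ∀ b', extCfg lo hi φ b' ∈ Matrix.specialUnitaryGroup (Fin N) ℂ := extCfg_mem hφ
  have hV : ∀ x κ, unitCfg (extCfg lo hi φ) x κ ∈ specialUnitaryUnits (Fin N) := fun x κ => by
    rw [mem_specialUnitaryUnits, val_unitCfg (isUnit_of_mem_unitary (Matrix.mem_specialUnitaryGroup_iff.mp
      (hφ' (x, κ))).1)]
    exact hφ' (x, κ)
  exact (mem_specialUnitaryUnits).mp (hol_mem_of hV y _)

/-- **TRACELESSNESS of `B(c)` on the `SU(N)` slice**: for `SU(N)`-valued `V` with (13)-type bounds `≤ α` on the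
plaquettes of a box containing `y` and `c`, `|c₋ − y|₁·α ≤ ¼` and `N·|c₋ − y|₁·α < π`, `tr B(c) = 0` — the loop
holonomy lies in `SU(N)` and `tr log W = 0` for `W ∈ SU(N)` near `1` (b07 `ExpMeanLog.trace_mlog_eq_zero`, with its
`G`-dependent radius). [cite: Balaban1985UV3, (27) p.263 ("𝓗(B) … 𝔤-valued"), (32) p.264] -/
theorem trace_B27_eq_zero {lo hi : LSite d} (hlohi : ∀ i, lo i ≤ hi i)
    {V : LSite d → Fin d → (Matrix (Fin N) (Fin N) ℂ)ˣ} (hV : ∀ x κ, V x κ ∈ specialUnitaryUnits (Fin N))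
    {y : LSite d} (hy : InBox lo hi y) {α : ℝ}
    (h44 : ∀ (x : LSite d) (κ μ : Fin d), κ ≠ μ → PlaqIn lo hi (x, κ, μ) →
      ‖((hol V x (plaqWord κ μ) : (Matrix (Fin N) (Fin N) ℂ)ˣ) : Matrix (Fin N) (Fin N) ℂ) - 1‖ ≤ α)
    (hα : 0 ≤ α) {x : LSite d} {μ : Fin d} (hx : InBox lo hi x) (hxμ : InBox lo hi (x + e μ))
    (hsmall : (l1 (x - y) : ℝ) * α ≤ 1 / 4) (hπ : (N : ℝ) * ((l1 (x - y) : ℝ) * α) < Real.pi) :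
    Matrix.trace (B27 V y x μ) = 0 := by
  have hU : ∀ x κ, V x κ ∈ unitaryUnits (Matrix (Fin N) (Fin N) ℂ) :=
    fun x κ => specialUnitaryUnits_le_unitaryUnits (hV x κ)
  have hW : ((hol V y (contour27 y x μ) : (Matrix (Fin N) (Fin N) ℂ)ˣ) : Matrix (Fin N) (Fin N) ℂ) ∈
      Matrix.specialUnitaryGroup (Fin N) ℂ := (mem_specialUnitaryUnits).mp (hol_mem_of hV y _)
  have hn := norm_hol_contour27_sub_one_le_local hlohi V (U1_of_unitaryUnits hU) y h44 hα hy x μ hx hxμ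
  have htr : Matrix.trace (mlog ((hol V y (contour27 y x μ) : (Matrix (Fin N) (Fin N) ℂ)ˣ) :
      Matrix (Fin N) (Fin N) ℂ)) = 0 :=
    ExpMeanLog.trace_mlog_eq_zero hW (hn.trans (hsmall.trans (by norm_num)))
      (by rw [Fintype.card_fin]; exact lt_of_le_of_lt (mul_le_mul_of_nonneg_left hn (Nat.cast_nonneg _)) hπ)
  rw [B27, Matrix.trace_smul, htr, smul_zero]

variable {lo hi : LSite d} {D : LocDomainSys} (y : D.Dom → LSite d) (R : D.Dom → ℕ)

/-- **`htr` on the box**: for `SU(N)`-valued `φ` with (13)-type bounds `≤ α` on the plaquettes of `Λ ∋ y X`,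
`R X·α ≤ ¼` and `N·R X·α < π`, the generator is TRACELESS at every bond. [cite: Balaban1985UV3, (32) p.264] -/
theorem trace_axialGenBox_eq_zero {X : D.Dom} (hy : InBox lo hi (y X))
    {φ : BoxBond lo hi → Matrix (Fin N) (Fin N) ℂ} (hφ : ∀ b, φ b ∈ Matrix.specialUnitaryGroup (Fin N) ℂ) {α : ℝ}
    (h13 : ∀ (x : LSite d) (κ μ : Fin d), κ ≠ μ → PlaqIn lo hi (x, κ, μ) → ‖plaq (extCfg lo hi φ) x κ μ - 1‖ ≤ α)
    (hα : 0 ≤ α) (hR : (R X : ℝ) * α ≤ 1 / 4) (hπ : (N : ℝ) * ((R X : ℝ) * α) < Real.pi) (b : BoxBond lo hi) :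
    Matrix.trace (axialGenBox lo hi y R X φ b) = 0 := by
  have hlohi : ∀ i, lo i ≤ hi i := fun i => (hy i).1.trans (hy i).2
  have hφ' : ∀ b', extCfg lo hi φ b' ∈ Matrix.specialUnitaryGroup (Fin N) ℂ := extCfg_mem hφ
  have hφu : ∀ b', extCfg lo hi φ b' ∈ unitary (Matrix (Fin N) (Fin N) ℂ) :=
    fun b' => (Matrix.mem_specialUnitaryGroup_iff.mp (hφ' b')).1
  have hV : ∀ x κ, unitCfg (extCfg lo hi φ) x κ ∈ specialUnitaryUnits (Fin N) := fun x κ => by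
    rw [mem_specialUnitaryUnits, val_unitCfg (isUnit_of_mem_unitary (hφu (x, κ)))]
    exact hφ' (x, κ)
  unfold axialGenBox
  split_ifs with h
  · have hl : (l1 (b.1.1 - y X) : ℝ) * α ≤ R X * α := mul_le_mul_of_nonneg_right (by exact_mod_cast h) hα
    rw [Matrix.trace_smul, trace_B27_eq_zero N hlohi hV hy (h44_of_plaq_local hφu h13) hα b.2.1 b.2.2 (hl.trans hR)
      (lt_of_le_of_lt (mul_le_mul_of_nonneg_left hl (Nat.cast_nonneg _)) hπ), smul_zero]
  · exact Matrix.trace_zero _ _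

/-- … hence it lies in the closure of `commSpan M_N(ℂ)` (`= 𝔰𝔩_N`, `B10Eq32SuN.coe_commSpan_matrix`) — gen 25's
binder `hcomm` of `B10Eq26SiteGauge.logHalfBound_sub_of_siteGaugeInv` DISCHARGED on the `SU(N)` slice.
[cite: Balaban1985UV3, (32) p.264] -/
theorem axialGenBox_mem_closure_commSpan {sp' : D.Dom → Set (BoxBond lo hi → Matrix (Fin N) (Fin N) ℂ)}
    (hy : ∀ X, InBox lo hi (y X))
    (hSU : ∀ X φ, φ ∈ sp' X → ∀ b, φ b ∈ Matrix.specialUnitaryGroup (Fin N) ℂ) {α : ℝ}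
    (h13 : ∀ X φ, φ ∈ sp' X → ∀ (x : LSite d) (κ μ : Fin d), κ ≠ μ → PlaqIn lo hi (x, κ, μ) →
      ‖plaq (extCfg lo hi φ) x κ μ - 1‖ ≤ α)
    (hα : 0 ≤ α) (hR : ∀ X, (R X : ℝ) * α ≤ 1 / 4) (hπ : ∀ X, (N : ℝ) * ((R X : ℝ) * α) < Real.pi) :
    ∀ X φ, φ ∈ sp' X → ∀ b, axialGenBox lo hi y R X φ b ∈ closure (commSpan (Matrix (Fin N) (Fin N) ℂ) : Set _) :=
  B10Eq32SuN.mem_closure_commSpan_of_trace_eq_zero N fun X φ hφ b =>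
    trace_axialGenBox_eq_zero N y R (hy X) (hSU X φ hφ) (h13 X φ hφ) hα (hR X) (hπ X) b

end suN

/-! ## §4a. [folklore] Real rays: invariance along `t ↦ t•w` (t real) gives invariance of the derivative -/

section ray

variable {V F : Type*} [NormedAddCommGroup V] [NormedSpace ℂ V] [NormedAddCommGroup F] [NormedSpace ℂ F]

/-- `t ↦ (t : ℂ)` has derivative `1`. [folklore] -/
theorem hasDerivAt_ofReal_zero : HasDerivAt (fun t : ℝ => (t : ℂ)) 1 0 := by
  have h : HasDerivAt (⇑Complex.ofRealCLM) (Complex.ofRealCLM 1) (0 : ℝ) := Complex.ofRealCLM.hasDerivAt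
  rw [Complex.ofRealCLM_apply, Complex.ofReal_one] at h
  exact h.congr_of_eventuallyEq (Eventually.of_forall fun t => (Complex.ofRealCLM_apply t).symm)

/-- Chain rule along a real ray through `0`: `d/dt|₀ g(t•v) = Dg(0) v`. [folklore] -/
theorem hasDerivAt_comp_ofReal_smul {g : V → F} (hg : DifferentiableAt ℂ g 0) (v : V) :
    HasDerivAt (fun t : ℝ => g ((t : ℂ) • v)) (fderiv ℂ g 0 v) 0 := by
  have hγ : HasDerivAt (fun t : ℝ => (t : ℂ) • v) ((1 : ℂ) • v) 0 := hasDerivAt_ofReal_zero.smul_const v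
  rw [one_smul] at hγ
  have h0 : ((0 : ℝ) : ℂ) • v = 0 := by simp
  have hg' : HasFDerivAt g ((fderiv ℂ g 0).restrictScalars ℝ) (((0 : ℝ) : ℂ) • v) := by
    rw [h0]; exact hg.hasFDerivAt.restrictScalars ℝ
  exact hg'.comp_hasDerivAt (0 : ℝ) hγ

/-- **Ray invariance ⇒ derivative invariance**: if `g(T(t•w)) = g(t•w)` for all real `t`, then `Dg(0)(T w) = Dg(0) w`
(uniqueness of the derivative of `t ↦ g(t•w)` at `0`). [folklore] -/
theorem fderiv_apply_eq_of_rayInvariant {g : V → F} (hg : DifferentiableAt ℂ g 0) (T : V →L[ℂ] V) {w : V}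
    (h : ∀ t : ℝ, g (T ((t : ℂ) • w)) = g ((t : ℂ) • w)) : fderiv ℂ g 0 (T w) = fderiv ℂ g 0 w := by
  have h1 := hasDerivAt_comp_ofReal_smul hg (T w)
  have heq : (fun t : ℝ => g ((t : ℂ) • T w)) = fun t : ℝ => g ((t : ℂ) • w) := by
    funext t; rw [← map_smul]; exact h t
  rw [heq] at h1
  exact h1.unique (hasDerivAt_comp_ofReal_smul hg w)

end ray

/-! ## §4b. [folklore] `M_N(ℂ) = 𝔰𝔲(N) ⊕ i𝔰𝔲(N) ⊕ ℂ·1` bondwise; one-parameter subgroups of `SU(N)` -/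

section su

variable (N : ℕ)

attribute [local instance] B10Eq29TubeLine.cstarAlgebraMatrix

/-- `exp(tS) ∈ SU(N)` for `S` skew-Hermitian traceless and `t` real (`det exp = exp tr`,
`Literature.Analysis.Matrix.det_exp_eq_exp_trace`). [folklore] -/
theorem exp_smul_mem_specialUnitaryGroup {S : Matrix (Fin N) (Fin N) ℂ} (hS : star S = -S)
    (h0 : Matrix.trace S = 0) (t : ℝ) : exp ((t : ℂ) • S) ∈ Matrix.specialUnitaryGroup (Fin N) ℂ := by
  rw [Matrix.mem_specialUnitaryGroup_iff]
  refine ⟨exp_ofReal_smul_mem_unitary (skewAdjoint.mem_iff.mpr hS) t, ?_⟩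
  rw [det_exp_eq_exp_trace, Matrix.trace_smul, h0, smul_zero, exp_zero]

/-- Conjugation by a unitary fixes the scalars: `W (c•1) W⋆ = c•1`. [folklore] -/
theorem conjCfg_eq_self_of_scalar {ι : Type*} {W : Matrix (Fin N) (Fin N) ℂ}
    (hW : W ∈ unitary (Matrix (Fin N) (Fin N) ℂ)) {w : ι → Matrix (Fin N) (Fin N) ℂ}
    (hw : ∀ b, ∃ c : ℂ, w b = c • 1) : conjCfg W (star W) w = w := by
  funext b
  obtain ⟨c, hc⟩ := hw b
  rw [conjCfg_apply, hc, mul_smul_comm, mul_one, smul_mul_assoc, Unitary.mul_star_self_of_mem hW]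

/-- **Bondwise decomposition** `w = ½A + (−i/2)B + C` with `A`, `B` valued in `𝔰𝔲(N)` and `C` scalar-valued
(`A_b = P_b − P_b⋆`, `B_b = i(P_b + P_b⋆)`, `P_b = w_b − (tr w_b/N)·1`; as in `B10Eq32SuN.mem_span_su_of_trace_eq_zero`).
[folklore] -/
theorem cfg_decomp [NeZero N] {ι : Type*} (w : ι → Matrix (Fin N) (Fin N) ℂ) :
    ∃ A B C : ι → Matrix (Fin N) (Fin N) ℂ,
      (∀ b, star (A b) = -A b ∧ Matrix.trace (A b) = 0) ∧ (∀ b, star (B b) = -B b ∧ Matrix.trace (B b) = 0) ∧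
      (∀ b, ∃ c : ℂ, C b = c • 1) ∧ w = (2 : ℂ)⁻¹ • A + (-Complex.I / 2) • B + C := by
  set P : ι → Matrix (Fin N) (Fin N) ℂ := fun b => w b - (Matrix.trace (w b) / N) • 1 with hP
  have hP0 : ∀ b, Matrix.trace (P b) = 0 := fun b => by
    have hN : (N : ℂ) ≠ 0 := Nat.cast_ne_zero.mpr (NeZero.ne N)
    simp only [hP, Matrix.trace_sub, Matrix.trace_smul, Matrix.trace_one, Fintype.card_fin, smul_eq_mul,
      div_mul_cancel₀ _ hN, sub_self]
  have hP' : ∀ b, Matrix.trace (star (P b)) = 0 := fun b => by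
    rw [Matrix.star_eq_conjTranspose, Matrix.trace_conjTranspose, hP0, star_zero]
  refine ⟨fun b => P b - star (P b), fun b => Complex.I • (P b + star (P b)),
    fun b => (Matrix.trace (w b) / N) • 1, fun b => ⟨?_, ?_⟩, fun b => ⟨?_, ?_⟩, fun b => ⟨_, rfl⟩, ?_⟩
  · rw [star_sub, star_star, neg_sub]
  · rw [Matrix.trace_sub, hP0, hP', sub_zero]
  · rw [star_smul, star_add, star_star, Complex.star_def, Complex.conj_I, neg_smul, add_comm]
  · rw [Matrix.trace_smul, Matrix.trace_add, hP0, hP', add_zero, smul_zero]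
  · funext b
    simp only [Pi.add_apply, Pi.smul_apply]
    have hdec : (2 : ℂ)⁻¹ • (P b - star (P b)) + (-Complex.I / 2) • (Complex.I • (P b + star (P b))) = P b := by
      rw [smul_smul, show -Complex.I / 2 * Complex.I = (2 : ℂ)⁻¹ by
        rw [div_mul_eq_mul_div, neg_mul, Complex.I_mul_I, neg_neg, one_div]]
      module
    rw [hdec, hP]
    simp only [sub_add_cancel]

/-- Two continuous linear maps on configurations that agree on the `𝔰𝔲(N)`-valued and on the scalar-valued
configurations agree (ℂ-linearity + `cfg_decomp`). [folklore] -/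
theorem clm_eq_of_su_of_scalar [NeZero N] {ι : Type*} {F : Type*} [AddCommGroup F] [Module ℂ F]
    [TopologicalSpace F] (ℓ₁ ℓ₂ : (ι → Matrix (Fin N) (Fin N) ℂ) →L[ℂ] F)
    (hsu : ∀ w : ι → Matrix (Fin N) (Fin N) ℂ, (∀ b, star (w b) = -w b ∧ Matrix.trace (w b) = 0) → ℓ₁ w = ℓ₂ w)
    (hsc : ∀ w : ι → Matrix (Fin N) (Fin N) ℂ, (∀ b, ∃ c : ℂ, w b = c • 1) → ℓ₁ w = ℓ₂ w) : ℓ₁ = ℓ₂ := by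
  ext w
  obtain ⟨A, B, C, hA, hB, hC, rfl⟩ := cfg_decomp N w
  simp only [map_add, map_smul, hsu A hA, hsu B hB, hsc C hC]

/-! ## §4c. (31) ⇒ (32) FROM THE REAL SLICE for `G = SU(N)` -/

variable {ι : Type*} [Fintype ι] {D : LocDomainSys}

/-- **(31) from (26) on the real slice**: if `E X` is invariant under the GLOBAL transformations `V ↦ W V W⋆`,
`W ∈ SU(N)`, on the `SU(N)`-VALUED configurations only ("(26) holds for all regular gauge field configurations"),
and differentiable near `1`, then its derivative at `1` in the exponential chart is `Ad(SU(N))`-invariant on ALL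
(complex) tangent configurations. [cite: Balaban1985UV3, (31) p.264] -/
theorem fderiv_comp_conjCfg_eq_of_suInvariant [NeZero N] {E : D.Dom → (ι → Matrix (Fin N) (Fin N) ℂ) → ℂ}
    {sp : Set (ι → Matrix (Fin N) (Fin N) ℂ)} {a : ℝ} (ha : 0 < a) {X : D.Dom}
    (hsp : TubeCfg ι (Matrix (Fin N) (Fin N) ℂ) a ⊆ sp) (hE : DifferentiableOn ℂ (E X) sp)
    (hconj : ∀ W ∈ Matrix.specialUnitaryGroup (Fin N) ℂ, ∀ V : ι → Matrix (Fin N) (Fin N) ℂ,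
      (∀ b, V b ∈ Matrix.specialUnitaryGroup (Fin N) ℂ) → E X (fun b => W * V b * star W) = E X V)
    {W : Matrix (Fin N) (Fin N) ℂ} (hW : W ∈ Matrix.specialUnitaryGroup (Fin N) ℂ) :
    (fderiv ℂ (fun v => E X (expChart (D := D) (fun _ _ => (1 : Matrix (Fin N) (Fin N) ℂ)) X v)) 0).comp
        (conjCfg W (star W)) =
      fderiv ℂ (fun v => E X (expChart (D := D) (fun _ _ => (1 : Matrix (Fin N) (Fin N) ℂ)) X v)) 0 := by
  set g : (ι → Matrix (Fin N) (Fin N) ℂ) → ℂ :=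
    fun v => E X (expChart (D := D) (fun _ _ => (1 : Matrix (Fin N) (Fin N) ℂ)) X v) with hg
  have hWu : W ∈ unitary (Matrix (Fin N) (Fin N) ℂ) := (Matrix.mem_specialUnitaryGroup_iff.mp hW).1
  have h1 : W * star W = 1 := Unitary.mul_star_self_of_mem hWu
  have h2 : star W * W = 1 := Unitary.star_mul_self_of_mem hWu
  have hdiff : DifferentiableAt ℂ g 0 :=
    differentiableAt_comp_expChart_zero ha (fun _ => one_mem _) hsp hE
  refine clm_eq_of_su_of_scalar N _ _ (fun w hw => ?_) (fun w hw => ?_)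
  · -- 𝔰𝔲(N)-valued tangent configurations: the real ray stays in the SU(N)-valued configurations
    rw [ContinuousLinearMap.comp_apply]
    refine fderiv_apply_eq_of_rayInvariant hdiff _ fun t => ?_
    simp only [hg]
    rw [expChart_one_conjCfg h1 h2]
    refine hconj W hW _ fun b => ?_
    simp only [expChart, Pi.smul_apply, mul_one]
    exact exp_smul_mem_specialUnitaryGroup N (hw b).1 (hw b).2 t
  · -- scalar-valued tangent configurations are fixed
    rw [ContinuousLinearMap.comp_apply, conjCfg_eq_self_of_scalar N hWu hw]

/-- **(32) FROM (26) ON THE REAL SLICE, `G = SU(N)`**: under the hypotheses of `fderiv_comp_conjCfg_eq_of_suInvariant`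
for every `X`, the derivative at `ζ = 0` of `E X` along the exponential line `ζ ↦ exp(ζ·gen X φ)` VANISHES for every
TRACELESS generator (`gen X φ b ∈ 𝔰𝔩_N = 𝔰𝔲(N)ᶜ = [𝔰𝔲(N), M_N]`: the printed "𝔤 semi-simple, the only element
invariant is 0") — the binder `h0 : DerivZeroAlongV` of `B10Eq29TubeLine.logHalfBound_expLine_of_derivZero`.
[cite: Balaban1985UV3, (31)–(32) p.264] -/
theorem derivZeroAlongV_of_suInvariant [NeZero N] {E : D.Dom → (ι → Matrix (Fin N) (Fin N) ℂ) → ℂ}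
    {sp sp' : D.Dom → Set (ι → Matrix (Fin N) (Fin N) ℂ)}
    {gen : D.Dom → (ι → Matrix (Fin N) (Fin N) ℂ) → ι → Matrix (Fin N) (Fin N) ℂ} {a : ℝ} (ha : 0 < a)
    (hsp : ∀ X, TubeCfg ι (Matrix (Fin N) (Fin N) ℂ) a ⊆ sp X) (hE : ∀ X, DifferentiableOn ℂ (E X) (sp X))
    (hconj : ∀ X, ∀ W ∈ Matrix.specialUnitaryGroup (Fin N) ℂ, ∀ V : ι → Matrix (Fin N) (Fin N) ℂ,
      (∀ b, V b ∈ Matrix.specialUnitaryGroup (Fin N) ℂ) → E X (fun b => W * V b * star W) = E X V)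
    (htr : ∀ X φ, φ ∈ sp' X → ∀ b, Matrix.trace (gen X φ b) = 0) :
    DerivZeroAlongV sp' E (expLine gen (fun _ _ _ => 1)) := by
  intro X φ hφ
  have hdiff : DifferentiableAt ℂ
      (fun v => E X (expChart (D := D) (fun _ _ => (1 : Matrix (Fin N) (Fin N) ℂ)) X v)) 0 :=
    differentiableAt_comp_expChart_zero ha (fun _ => one_mem _) (hsp X) (hE X)
  set ℓ := fderiv ℂ (fun v => E X (expChart (D := D) (fun _ _ => (1 : Matrix (Fin N) (Fin N) ℂ)) X v)) 0 with hℓ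
  -- (31) ⇒ ℓ ∘ (flow of every S ∈ 𝔰𝔲(N)) = ℓ, hence ℓ kills every ad_S w
  have had : ∀ (l : {S : Matrix (Fin N) (Fin N) ℂ // star S = -S ∧ Matrix.trace S = 0})
      (w : ι → Matrix (Fin N) (Fin N) ℂ), ℓ (adCfg (l : Matrix (Fin N) (Fin N) ℂ) w) = 0 := by
    rintro ⟨S, hS, hS0⟩ w
    refine apply_generator_eq_zero_of_comp_eq ℓ (hasDerivAt_gaugeFlow S w) (Eventually.of_forall fun t => ?_)
    have hW := exp_smul_mem_specialUnitaryGroup N hS hS0 t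
    have hflow : gaugeFlow S t w = conjCfg (exp ((t : ℂ) • S)) (star (exp ((t : ℂ) • S))) w := by
      rw [star_exp_ofReal_smul (skewAdjoint.mem_iff.mpr hS) t]; rfl
    rw [hflow, ← ContinuousLinearMap.comp_apply, hℓ,
      fderiv_comp_conjCfg_eq_of_suInvariant N ha (hsp X) (hE X) (hconj X) hW]
  -- ℓ vanishes on the closed span of the ranges of the ad_S, which contains the traceless generator
  have hle : Submodule.span ℂ (⋃ l : {S : Matrix (Fin N) (Fin N) ℂ // star S = -S ∧ Matrix.trace S = 0},
      Set.range (adCfg (ι := ι) (l : Matrix (Fin N) (Fin N) ℂ))) ≤ LinearMap.ker ℓ.toLinearMap := by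
    refine Submodule.span_le.mpr fun v hv => ?_
    obtain ⟨l, hl⟩ := Set.mem_iUnion.mp hv
    obtain ⟨w, rfl⟩ := hl
    exact had l w
  have hker := closure_minimal (t := {v : ι → Matrix (Fin N) (Fin N) ℂ | ℓ v = 0}) (fun v hv => hle hv)
    (isClosed_eq ℓ.continuous continuous_const)
  have hmem := mem_closure_span_range_adCfg
    (fun l : {S : Matrix (Fin N) (Fin N) ℂ // star S = -S ∧ Matrix.trace S = 0} => (l : Matrix (Fin N) (Fin N) ℂ))
    (B10Eq32SuN.mem_closure_span_suFlow_of_trace_eq_zero N htr X φ hφ)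
  have hℓgen : ℓ (gen X φ) = 0 := hker hmem
  -- chain rule along the complex line ζ ↦ ζ • gen X φ
  have hγ : HasDerivAt (fun ζ : ℂ => ζ • gen X φ) (gen X φ) 0 := by
    simpa using (hasDerivAt_id (0 : ℂ)).smul_const (gen X φ)
  have hf : HasFDerivAt (fun v => E X (expChart (D := D) (fun _ _ => (1 : Matrix (Fin N) (Fin N) ℂ)) X v)) ℓ
      ((fun ζ : ℂ => ζ • gen X φ) 0) := by
    simpa only [zero_smul] using hdiff.hasFDerivAt
  have hc : HasDerivAt ((fun v => E X (expChart (D := D) (fun _ _ => (1 : Matrix (Fin N) (Fin N) ℂ)) X v)) ∘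
      fun ζ : ℂ => ζ • gen X φ) (ℓ (gen X φ)) 0 := hf.comp_hasDerivAt (0 : ℂ) hγ
  have heq : (fun ζ => E X (expLine gen (fun _ _ _ => 1) X φ ζ)) =
      ((fun v => E X (expChart (D := D) (fun _ _ => (1 : Matrix (Fin N) (Fin N) ℂ)) X v)) ∘
        fun ζ : ℂ => ζ • gen X φ) := rfl
  rw [heq, hc.deriv, hℓgen]

end su

/-! ## §5. THE JOINT THEOREMS ON THE BOX, `G = SU(N)`: (26) ⇒ (29) and (26) ⇒ (31) ⇒ (32) ⇒ the `LogHalfBound` for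
## `E X φ − E X 1`, every gauge-side binder a theorem -/

section joint

variable (N : ℕ) [NeZero N] {d : ℕ} {lo hi : LSite d} {D : LocDomainSys}

attribute [local instance] B10Eq29TubeLine.cstarAlgebraMatrix

/-- `M_N(ℂ)`. -/
local notation "M[" N "]" => Matrix (Fin N) (Fin N) ℂ

/-- **(29) ON THE BOX FOR `SU(N)`-VALUED GAUGE FIXINGS**: (26) for all `SU(N)`-valued site-dependent transformations
(b13's `SiteGaugeInvSU`) + localization of `E X` to bonds `dep X` within `ℓ¹`-radius `R X` of `y X ∈ Λ` +
`SU(N)`-valuedness and plaquette regularity `≤ α` (inside `Λ`) of the configurations of `sp′ X` + `R X·α < 1` ⇒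
`E X φ = E X (exp(iB_φ))` with `iB_φ =` the truncated axial generator — the datum is the axial gauge `v₀`, which is
`SU(N)`-VALUED (§3), so only `SU(N)`-valued transformations are used (gen 25's `eq29_of_gaugeFix` with the admissible
class "`SU(N)`-valued"). [cite: Balaban1985UV3, (26) p.263, (27) p.263, (29) p.263] -/
theorem eq29_axialBox (y : D.Dom → LSite d) (hy : ∀ X, InBox lo hi (y X)) (R : D.Dom → ℕ) {α : ℝ} (hα : 0 ≤ α)
    (hR : ∀ X, (R X : ℝ) * α < 1) {E : D.Dom → (BoxBond lo hi → M[N]) → ℂ}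
    {sp' : D.Dom → Set (BoxBond lo hi → M[N])} {dep : D.Dom → Set (BoxBond lo hi)}
    (hloc : ∀ X (V V' : BoxBond lo hi → M[N]), (∀ b ∈ dep X, V b = V' b) → E X V = E X V')
    (h26 : ∀ X, SiteGaugeInvSU (boxEnds lo hi) (E X))
    (hSU : ∀ X φ, φ ∈ sp' X → ∀ b, φ b ∈ Matrix.specialUnitaryGroup (Fin N) ℂ)
    (h13 : ∀ X φ, φ ∈ sp' X → ∀ (x : LSite d) (κ μ : Fin d), κ ≠ μ → PlaqIn lo hi (x, κ, μ) →
      ‖plaq (extCfg lo hi φ) x κ μ - 1‖ ≤ α)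
    (hdep : ∀ X, ∀ b ∈ dep X, l1 (b.1.1 - y X) ≤ R X) :
    ∀ X φ, φ ∈ sp' X → E X φ = E X (expLine (axialGenBox lo hi y R) (fun _ _ _ => 1) X φ 1) :=
  eq29_of_gaugeFix (boxEnds lo hi) (P := fun _ u => ∀ x, u x ∈ Matrix.specialUnitaryGroup (Fin N) ℂ) hloc
    (fun X φ hφ u hu => h26 X u hu φ (hSU X φ hφ))
    fun X φ hφ => ⟨_, fun x => axialFn_mem_specialUnitaryGroup N (hSU X φ hφ) (y X) x, fun b hb =>
      axial_gaugeFix_box y R (hy X) (fun b' => (Matrix.mem_specialUnitaryGroup_iff.mp (hSU X φ hφ b')).1)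
        (h13 X φ hφ) hα (hR X) b (hdep X b hb)⟩

/-- **THE PRINT-FAITHFUL JOINT THEOREM, `G = SU(N)`** — (26) in the `SU(N)`-form (b13's `SiteGaugeInvSU`, for every
`X`) + localization (`hloc`, `hdep`) + `SU(N)`-valuedness (`hSU`) and (13)-type plaquette regularity `≤ α` inside `Λ`
(`h13`) of the configurations of `sp′ X` + the smallness `R X·α ≤ 1/4`, `N·R X·α < π`, `2R X·α ≤ p + q(1 + d(X))` +
holomorphy of `E X` on a set `sp X ⊇` the `a`-tube (`hsp`, `hE`) + the `LogHalfBound` input `(B, r)` on `sp` (`hEb`)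
⇒ the `LogHalfBound` `(8((p + q)/a)²B, r − 2)` for `E X φ − E X 1` on `sp′`.  EVERY gauge-side binder of the engine
`B10Eq29TubeLine.logHalfBound_expLine_of_derivZero` and of (29) is a THEOREM here: `hgen` (§2
`axialGenBox_mem_skewAdjoint`), `hbase` (`1` unitary), `hbound` (§2 `norm_axialGenBox_le`), `h0 = (32)` (§4
`derivZeroAlongV_of_suInvariant` from (26) at `u ≡ W ∈ SU(N)` ON THE REAL SLICE and §3's tracelessness), `hfix` (§2–§3,
inside `eq29_axialBox`).
[cite: Balaban1985UV3, (26) p.263, (27)–(29) p.263, (31)–(32) p.264, (61) p.271; Balaban1988RG2Cluster, p.21] -/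
theorem logHalfBound_sub_box_of_siteGaugeInvSU {B r a p q : ℝ} (ha : 0 < a) (hp : 0 ≤ p) (hq : 0 ≤ q)
    (hpq : 0 < p + q) (hB : 0 ≤ B) (y : D.Dom → LSite d) (hy : ∀ X, InBox lo hi (y X)) (R : D.Dom → ℕ) {α : ℝ}
    (hα : 0 ≤ α) (hR4 : ∀ X, (R X : ℝ) * α ≤ 1 / 4) (hRπ : ∀ X, (N : ℝ) * ((R X : ℝ) * α) < Real.pi)
    (hRpq : ∀ X, 2 * ((R X : ℝ) * α) ≤ p + q * (1 + D.dj X)) {E : D.Dom → (BoxBond lo hi → M[N]) → ℂ}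
    {sp' sp : D.Dom → Set (BoxBond lo hi → M[N])} {dep : D.Dom → Set (BoxBond lo hi)} {nX : D.Dom → ℕ}
    (hsp : ∀ X, TubeCfg (BoxBond lo hi) M[N] a ⊆ sp X) (hE : ∀ X, DifferentiableOn ℂ (E X) (sp X))
    (h26 : ∀ X, SiteGaugeInvSU (boxEnds lo hi) (E X)) (hEb : B13.LogHalfBound D sp E nX B r)
    (hloc : ∀ X (V V' : BoxBond lo hi → M[N]), (∀ b ∈ dep X, V b = V' b) → E X V = E X V')
    (hSU : ∀ X φ, φ ∈ sp' X → ∀ b, φ b ∈ Matrix.specialUnitaryGroup (Fin N) ℂ)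
    (h13 : ∀ X φ, φ ∈ sp' X → ∀ (x : LSite d) (κ μ : Fin d), κ ≠ μ → PlaqIn lo hi (x, κ, μ) →
      ‖plaq (extCfg lo hi φ) x κ μ - 1‖ ≤ α)
    (hdep : ∀ X, ∀ b ∈ dep X, l1 (b.1.1 - y X) ≤ R X) :
    B13.LogHalfBound D sp' (fun X φ => E X φ - E X (fun _ => 1)) nX (8 * ((p + q) / a) ^ 2 * B) (r - 2) := by
  have hU : ∀ X φ, φ ∈ sp' X → ∀ b, φ b ∈ unitary M[N] :=
    fun X φ hφ b => (Matrix.mem_specialUnitaryGroup_iff.mp (hSU X φ hφ b)).1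
  have hgen : ∀ X φ, φ ∈ sp' X → ∀ b, axialGenBox lo hi y R X φ b ∈ skewAdjoint M[N] :=
    fun X φ hφ b => axialGenBox_mem_skewAdjoint y R (hy X) (hU X φ hφ) (h13 X φ hφ) hα (hR4 X) b
  have hbound : ∀ X φ, φ ∈ sp' X → ∀ b, ‖axialGenBox lo hi y R X φ b‖ ≤ p + q * (1 + D.dj X) :=
    fun X φ hφ b => (norm_axialGenBox_le y R (hy X) (hU X φ hφ) (h13 X φ hφ) hα
      ((hR4 X).trans (by norm_num)) b).trans (hRpq X)
  have hconj : ∀ X, ∀ W ∈ Matrix.specialUnitaryGroup (Fin N) ℂ, ∀ V : BoxBond lo hi → M[N],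
      (∀ b, V b ∈ Matrix.specialUnitaryGroup (Fin N) ℂ) → E X (fun b => W * V b * star W) = E X V := by
    intro X W hW V hV
    have h := h26 X (fun _ => W) (fun _ => hW) V hV
    rwa [gaugeAct_const (boxEnds lo hi) (Matrix.mem_specialUnitaryGroup_iff.mp hW).1 V] at h
  have htr : ∀ X φ, φ ∈ sp' X → ∀ b, Matrix.trace (axialGenBox lo hi y R X φ b) = 0 :=
    fun X φ hφ b => trace_axialGenBox_eq_zero N y R (hy X) (hSU X φ hφ) (h13 X φ hφ) hα (hR4 X) (hRπ X) b
  have h0 : DerivZeroAlongV sp' E (expLine (axialGenBox lo hi y R) (fun _ _ _ => 1)) :=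
    derivZeroAlongV_of_suInvariant N ha hsp hE hconj htr
  have h29 := eq29_axialBox N y hy R hα (fun X => lt_of_le_of_lt (hR4 X) (by norm_num)) hloc h26 hSU h13 hdep
  exact logHalfBound_congr (diffAlongV_eq_sub h29)
    (logHalfBound_expLine_of_derivZero ha hp hq hpq hB hgen (fun X φ _ b => one_mem _) hbound hsp hE h0 hEb)

/-- **GEN 25 §7 INSTANTIATED (`U(N)`-form)** — `B10Eq26SiteGauge.logHalfBound_sub_of_siteGaugeInv` on the box
carrier with the truncated axial generator: its binders `hgen`, `hbound` (§2), `hcomm` (§3: tracelessness on the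
`SU(N)` slice), `hU`, `hfix` (§2–§3, `u = v₀` `SU(N)`- hence unitary-valued) are ALL THEOREMS; the hypothesis is the
`U(N)`-form (26) `SiteGaugeInv` of gen 25 (STRICTLY stronger than `SiteGaugeInvSU`, b13 gen 22 (T1); `U(N)` is not
semi-simple — HONEST SCOPE (vii)).  The same conclusion also follows from `logHalfBound_sub_box_of_siteGaugeInvSU` via
`siteGaugeInvSU_of_siteGaugeInv` (the `example` below).
[cite: Balaban1985UV3, (26) p.263, (27)–(29) p.263, (31)–(32) p.264; Balaban1988RG2Cluster, p.21] -/
theorem logHalfBound_sub_box_of_siteGaugeInv {B r a p q : ℝ} (ha : 0 < a) (hp : 0 ≤ p) (hq : 0 ≤ q)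
    (hpq : 0 < p + q) (hB : 0 ≤ B) (y : D.Dom → LSite d) (hy : ∀ X, InBox lo hi (y X)) (R : D.Dom → ℕ) {α : ℝ}
    (hα : 0 ≤ α) (hR4 : ∀ X, (R X : ℝ) * α ≤ 1 / 4) (hRπ : ∀ X, (N : ℝ) * ((R X : ℝ) * α) < Real.pi)
    (hRpq : ∀ X, 2 * ((R X : ℝ) * α) ≤ p + q * (1 + D.dj X)) {E : D.Dom → (BoxBond lo hi → M[N]) → ℂ}
    {sp' sp : D.Dom → Set (BoxBond lo hi → M[N])} {dep : D.Dom → Set (BoxBond lo hi)} {nX : D.Dom → ℕ}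
    (hsp : ∀ X, TubeCfg (BoxBond lo hi) M[N] a ⊆ sp X) (hE : ∀ X, DifferentiableOn ℂ (E X) (sp X))
    (h26 : ∀ X, SiteGaugeInv (boxEnds lo hi) (E X)) (hEb : B13.LogHalfBound D sp E nX B r)
    (hloc : ∀ X (V V' : BoxBond lo hi → M[N]), (∀ b ∈ dep X, V b = V' b) → E X V = E X V')
    (hSU : ∀ X φ, φ ∈ sp' X → ∀ b, φ b ∈ Matrix.specialUnitaryGroup (Fin N) ℂ)
    (h13 : ∀ X φ, φ ∈ sp' X → ∀ (x : LSite d) (κ μ : Fin d), κ ≠ μ → PlaqIn lo hi (x, κ, μ) →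
      ‖plaq (extCfg lo hi φ) x κ μ - 1‖ ≤ α)
    (hdep : ∀ X, ∀ b ∈ dep X, l1 (b.1.1 - y X) ≤ R X) :
    B13.LogHalfBound D sp' (fun X φ => E X φ - E X (fun _ => 1)) nX (8 * ((p + q) / a) ^ 2 * B) (r - 2) := by
  have hU : ∀ X φ, φ ∈ sp' X → ∀ b, φ b ∈ unitary M[N] :=
    fun X φ hφ b => (Matrix.mem_specialUnitaryGroup_iff.mp (hSU X φ hφ b)).1
  refine logHalfBound_sub_of_siteGaugeInv (boxEnds lo hi) ha hp hq hpq hB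
    (fun X φ hφ b => axialGenBox_mem_skewAdjoint y R (hy X) (hU X φ hφ) (h13 X φ hφ) hα (hR4 X) b)
    (fun X φ hφ b => (norm_axialGenBox_le y R (hy X) (hU X φ hφ) (h13 X φ hφ) hα
      ((hR4 X).trans (by norm_num)) b).trans (hRpq X))
    hsp hE h26 (axialGenBox_mem_closure_commSpan N y R hy hSU h13 hα hR4 hRπ) hEb hloc hU fun X φ hφ => ?_
  exact ⟨_, fun x => (Matrix.mem_specialUnitaryGroup_iff.mp
      (axialFn_mem_specialUnitaryGroup N (hSU X φ hφ) (y X) x)).1,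
    fun b hb => axial_gaugeFix_box y R (hy X) (hU X φ hφ) (h13 X φ hφ) hα
      (lt_of_le_of_lt (hR4 X) (by norm_num)) b (hdep X b hb)⟩

/-- The `U(N)`-form also follows from the `SU(N)`-form (`SiteGaugeInv ⇒ SiteGaugeInvSU`, b13 gen 22). [folklore] -/
example {B r a p q : ℝ} (ha : 0 < a) (hp : 0 ≤ p) (hq : 0 ≤ q)
    (hpq : 0 < p + q) (hB : 0 ≤ B) (y : D.Dom → LSite d) (hy : ∀ X, InBox lo hi (y X)) (R : D.Dom → ℕ) {α : ℝ}
    (hα : 0 ≤ α) (hR4 : ∀ X, (R X : ℝ) * α ≤ 1 / 4) (hRπ : ∀ X, (N : ℝ) * ((R X : ℝ) * α) < Real.pi)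
    (hRpq : ∀ X, 2 * ((R X : ℝ) * α) ≤ p + q * (1 + D.dj X)) {E : D.Dom → (BoxBond lo hi → M[N]) → ℂ}
    {sp' sp : D.Dom → Set (BoxBond lo hi → M[N])} {dep : D.Dom → Set (BoxBond lo hi)} {nX : D.Dom → ℕ}
    (hsp : ∀ X, TubeCfg (BoxBond lo hi) M[N] a ⊆ sp X) (hE : ∀ X, DifferentiableOn ℂ (E X) (sp X))
    (h26 : ∀ X, SiteGaugeInv (boxEnds lo hi) (E X)) (hEb : B13.LogHalfBound D sp E nX B r)
    (hloc : ∀ X (V V' : BoxBond lo hi → M[N]), (∀ b ∈ dep X, V b = V' b) → E X V = E X V')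
    (hSU : ∀ X φ, φ ∈ sp' X → ∀ b, φ b ∈ Matrix.specialUnitaryGroup (Fin N) ℂ)
    (h13 : ∀ X φ, φ ∈ sp' X → ∀ (x : LSite d) (κ μ : Fin d), κ ≠ μ → PlaqIn lo hi (x, κ, μ) →
      ‖plaq (extCfg lo hi φ) x κ μ - 1‖ ≤ α)
    (hdep : ∀ X, ∀ b ∈ dep X, l1 (b.1.1 - y X) ≤ R X) :
    B13.LogHalfBound D sp' (fun X φ => E X φ - E X (fun _ => 1)) nX (8 * ((p + q) / a) ^ 2 * B) (r - 2) :=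
  logHalfBound_sub_box_of_siteGaugeInvSU N ha hp hq hpq hB y hy R hα hR4 hRπ hRpq hsp hE
    (fun X => siteGaugeInvSU_of_siteGaugeInv (boxEnds lo hi) (h26 X)) hEb hloc hSU h13 hdep

end joint

/-! ## §6. [folklore] NON-VACUITY: the hypotheses of `eq29_axialBox` are jointly satisfiable with `E` free — on a
## segment of `ℤ¹` every `SU(N)`-valued configuration is a pure gauge, so (26)\_{SU} alone forces `E X φ = E X 1` -/

section toys

variable (N : ℕ) [NeZero N]

attribute [local instance] B10Eq29TubeLine.cstarAlgebraMatrix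

/-- **(29) on a box of `ℤ¹`, with content.**  In `d = 1` there are no plaquettes (`α = 0`, `B ≡ 0`); with `dep X =`
all bonds, `y X = lo` and `R X =` the `ℓ¹`-radius of the box, `eq29_axialBox` applies and yields: a family `E X`
invariant under all `SU(N)`-valued site-dependent transformations of the box is CONSTANT on the `SU(N)`-valued
configurations, `E X φ = E X 1`.  All hypotheses of `eq29_axialBox` are thus jointly satisfiable, `D`, `E` free.
[folklore] -/
theorem eq29_box_dim_one {lo hi : LSite 1} (hlohi : ∀ i, lo i ≤ hi i) {D : LocDomainSys}
    (E : D.Dom → (BoxBond lo hi → Matrix (Fin N) (Fin N) ℂ) → ℂ) (h26 : ∀ X, SiteGaugeInvSU (boxEnds lo hi) (E X)) :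
    ∀ X φ, (∀ b, φ b ∈ Matrix.specialUnitaryGroup (Fin N) ℂ) → E X φ = E X (fun _ => 1) := by
  intro X φ hφ
  have hy : InBox lo hi lo := fun i => ⟨le_rfl, hlohi i⟩
  have hRb : ∀ b : BoxBond lo hi, l1 (b.1.1 - lo) ≤ Finset.univ.sup (fun b : BoxBond lo hi => l1 (b.1.1 - lo)) :=
    fun b => Finset.le_sup (f := fun b : BoxBond lo hi => l1 (b.1.1 - lo)) (Finset.mem_univ b)
  have h := eq29_axialBox N (D := D) (fun _ => lo) (fun _ => hy)
    (fun _ => Finset.univ.sup (fun b : BoxBond lo hi => l1 (b.1.1 - lo))) (α := 0) le_rfl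
    (fun _ => by rw [mul_zero]; exact one_pos) (E := E)
    (sp' := fun _ => {ψ | ∀ b, ψ b ∈ Matrix.specialUnitaryGroup (Fin N) ℂ}) (dep := fun _ => Set.univ)
    (fun X V V' hVV' => by rw [show V = V' from funext fun b => hVV' b (Set.mem_univ b)])
    h26 (fun _ _ hψ => hψ) (fun _ _ _ _ κ μ hne _ => absurd (Subsingleton.elim κ μ) hne)
    (fun _ b _ => hRb b) X φ hφ
  rw [h, expLine_one_one]
  congr 1
  funext b
  have hφu : ∀ b', extCfg lo hi φ b' ∈ unitary (Matrix (Fin N) (Fin N) ℂ) :=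
    extCfg_mem fun b => (Matrix.mem_specialUnitaryGroup_iff.mp (hφ b)).1
  rw [axialGenBox_of_le _ _ _ (hRb b), B27_eq_zero_dim_one (unitCfg (extCfg lo hi φ))
    (U1_of_unitaryUnits (unitCfg_mem_unitaryUnits hφu)), smul_zero, exp_zero]

/-- The box carrier is inhabited as soon as the box has an edge: the bond `⟨lo, lo + e_μ⟩` for `lo + e_μ ≤ hi`.
[folklore] -/
example {d : ℕ} {lo hi : LSite d} (hlohi : ∀ i, lo i ≤ hi i) (μ : Fin d) (hμ : lo μ + 1 ≤ hi μ) :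
    Nonempty (BoxBond lo hi) := by
  refine ⟨⟨(lo, μ), fun i => ⟨le_rfl, hlohi i⟩, fun i => ?_⟩⟩
  by_cases h : i = μ
  · subst h
    simp only [Pi.add_apply, B7Prop1Explicit.e, Pi.single_eq_same]
    exact ⟨by omega, hμ⟩
  · simp only [Pi.add_apply, B7Prop1Explicit.e, Pi.single_eq_of_ne h, add_zero]
    exact ⟨le_rfl, hlohi i⟩

end toys

end Literature.MathematicalPhysics.QuantumFieldTheory.Balaban1983to89.B10Eq32AxialSuN
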